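import Mathlib
import HarnessLib
import Summits.HubbardSuperconductivity.HubbardSuperconductivity.Theorems.ChiralWindowDefs

/-!
# Crux `CwKLChiralWindow` (stmt-1741), line `Sketch`: the cover logic of the checker (F5)

Pure combinatorics of `KLCert.check` (`Theorems/ChiralWindowDefs.lean`): if the checker accepts the record `c`
then the window ends and constants are in range, every box passes `basicOK`/`isolationOK`/`nodeOK`, every real
`μ ∈ [μ_b, μ_a]` lies in some box (the boxes are contiguous — `chainOK` — from a box starting below `μ_b` to a box
ending above `μ_a`), and the two `any` clauses give a box containing `μ_a` with `b1gLeadsOK` and a box containing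
`μ_b` with `eLeadsOK` (`stub_klCoverLogic`).  The only real lemma is the chain cover `kl_cvl_chain_cover`
(induction on the list of boxes).
-/

noncomputable section

set_option linter.dupNamespace false

namespace Summit.HubbardSuperconductivity.HubbardSuperconductivity.Theorems

open MeasureTheory Literature.MathematicalPhysics.QuantumLattice CwKLChiralWindow

/-- **Chain cover.** If the boxes `b₀ :: L` are contiguous (`chainOK`) and `b₁` is the last one, then every real
`μ` with `b₀.mulo ≤ μ ≤ b₁.muhi` lies in one of the boxes. [folklore] -/
theorem kl_cvl_chain_cover : ∀ (L : List KLBox) (b₀ b₁ : KLBox), KLCert.chainOK (b₀ :: L) = true →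
    (b₀ :: L).getLast? = some b₁ →
    ∀ μ : ℝ, ((b₀.mulo : ℚ) : ℝ) ≤ μ → μ ≤ ((b₁.muhi : ℚ) : ℝ) →
    ∃ bx ∈ b₀ :: L, ((bx.mulo : ℚ) : ℝ) ≤ μ ∧ μ ≤ ((bx.muhi : ℚ) : ℝ) := by
  intro L
  induction L with
  | nil =>
    intro b₀ b₁ _ hlast μ h₁ h₂
    have hb : b₁ = b₀ := by simpa [eq_comm] using hlast
    subst hb
    exact ⟨b₁, List.mem_cons_self, h₁, h₂⟩
  | cons b L ih =>
    intro b₀ b₁ hch hlast μ h₁ h₂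
    simp only [KLCert.chainOK, Bool.and_eq_true, decide_eq_true_eq] at hch
    rw [List.getLast?_cons_cons] at hlast
    by_cases hμ : μ ≤ ((b₀.muhi : ℚ) : ℝ)
    · exact ⟨b₀, List.mem_cons_self, h₁, hμ⟩
    · have hb : ((b.mulo : ℚ) : ℝ) ≤ μ := by
        have h' : ((b.mulo : ℚ) : ℝ) ≤ ((b₀.muhi : ℚ) : ℝ) := by exact_mod_cast hch.1
        exact h'.trans (le_of_lt (lt_of_not_ge hμ))
      obtain ⟨bx, hbx, hbx'⟩ := ih b b₁ hch.2 hlast μ hb h₂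
      exact ⟨bx, List.mem_cons_of_mem _ hbx, hbx'⟩

/-- **Cover logic (F5).** What `KLCert.check = true` says, unpacked: the window ends and constants are in range,
every box passes `basicOK`, `isolationOK` and `nodeOK`, every `μ ∈ [μ_b, μ_a]` lies in some box (the boxes are
contiguous from below `μ_b` to above `μ_a`), some box containing `μ_a` passes `b1gLeadsOK` and some box containing
`μ_b` passes `eLeadsOK`. [folklore] -/
theorem stub_klCoverLogic : ∀ c : KLCert, c.check = true →
    (-4 < c.mub ∧ c.mub < c.mua ∧ c.mua < 0 ∧ 0 < c.gamma ∧ 0 < c.cov) ∧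
    (∀ bx ∈ c.boxes, bx.basicOK c.trials = true ∧ bx.isolationOK c.trials c.gamma = true ∧
      bx.nodeOK c.trials c.cov = true) ∧
    (∀ μ : ℝ, ((c.mub : ℚ) : ℝ) ≤ μ → μ ≤ ((c.mua : ℚ) : ℝ) →
      ∃ bx ∈ c.boxes, ((bx.mulo : ℚ) : ℝ) ≤ μ ∧ μ ≤ ((bx.muhi : ℚ) : ℝ)) ∧
    (∃ bx ∈ c.boxes, bx.mulo ≤ c.mua ∧ c.mua ≤ bx.muhi ∧ bx.b1gLeadsOK c.trials c.gamma = true) ∧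
    (∃ bx ∈ c.boxes, bx.mulo ≤ c.mub ∧ c.mub ≤ bx.muhi ∧ bx.eLeadsOK c.trials c.gamma = true) := by
  intro c hc
  unfold KLCert.check at hc
  simp only [Bool.and_eq_true, decide_eq_true_eq] at hc
  obtain ⟨⟨⟨⟨⟨⟨⟨⟨⟨h₁, h₂⟩, h₃⟩, h₄⟩, h₅⟩, hmatch⟩, hchain⟩, hall⟩, hany₁⟩, hany₂⟩ := hc
  refine ⟨⟨h₁, h₂, h₃, h₄, h₅⟩, ?_, ?_, ?_, ?_⟩
  · intro bx hbx
    have h := List.all_eq_true.1 hall bx hbx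
    simp only [Bool.and_eq_true] at h
    exact ⟨h.1.1, h.1.2, h.2⟩
  · intro μ hμ₁ hμ₂
    split at hmatch
    · rename_i b₀ b₁ hb₀ hb₁
      simp only [Bool.and_eq_true, decide_eq_true_eq] at hmatch
      obtain ⟨L, hL⟩ := List.head?_eq_some_iff.1 hb₀
      rw [hL] at hchain hb₁ ⊢
      have hlo : ((b₀.mulo : ℚ) : ℝ) ≤ μ := le_trans (by exact_mod_cast hmatch.1) hμ₁
      have hhi : μ ≤ ((b₁.muhi : ℚ) : ℝ) := le_trans hμ₂ (by exact_mod_cast hmatch.2)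
      exact kl_cvl_chain_cover L b₀ b₁ hchain hb₁ μ hlo hhi
    · exact absurd hmatch Bool.false_ne_true
  · obtain ⟨bx, hbx, h⟩ := List.any_eq_true.1 hany₁
    simp only [Bool.and_eq_true, decide_eq_true_eq] at h
    exact ⟨bx, hbx, h.1.1, h.1.2, h.2⟩
  · obtain ⟨bx, hbx, h⟩ := List.any_eq_true.1 hany₂
    simp only [Bool.and_eq_true, decide_eq_true_eq] at h
    exact ⟨bx, hbx, h.1.1, h.1.2, h.2⟩

end Summit.HubbardSuperconductivity.HubbardSuperconductivity.Theorems

end
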